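import Literature.NumberTheory.Connes2026.LetterSemilocal
import Literature.Analysis.FunctionSpaces.PlancherelL1L2
import Mathlib.Analysis.SpecialFunctions.Trigonometric.Series
import Mathlib.Analysis.SpecialFunctions.Exponential
import HarnessLib

/-!
# Connes 1999 Thm V.3 / Letter §7.1, archimedean cutoff trace — OPERATOR HALF:
# the diagonal series of `ϑ(f) 𝔽 P_Λ 𝔽⁻¹ P_Λ` along any Hilbert basis of `L²(ℝ)_ev` is the CC2021 `Δ`-integral

LABEL (line 1): RH-FREE literature (theorems only: no definition, no named fact).  bears_on: LADDER-RH
W-C/W-P (C1), cell `rh-crit`, sub-cell cc, overflow row O1 — green layer under the row's named fact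
`Connes1999_thm_VII_4_rat` (its archimedean instance `P = ∅`), record only.  WHAT THIS IS NOT: any claim
about positivity or about RH — a trace formula for cutoffs says nothing about the zeros; nothing here bears
on the truth of RH.

Sources.  A. Connes, *Trace formula in noncommutative geometry and the zeros of the Riemann zeta function*,
Selecta Math. 5 (1999) [`Connes1999`], §V Thm 3 (`K = ℝ`) and §VII Thm 4; A. Connes, *The Riemann
Hypothesis: past, present and a letter through time*, arXiv:2602.04022 [`Connes2026Letter`], §7.1 (display);
A. Connes, C. Consani, *Weil positivity and trace formula, the archimedean place*, Selecta Math. 27 (2021)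
77 = arXiv:2006.13771 [`ConnesConsani2021`], §1 Prop. 1.5 (= arXiv Prop. 8) (ii)–(iii): the trace of
`ϑ(ρ⁻¹)·(cutoffs)` as the square integral `4ρ^{1/2}∫∫ cos(2πρxy)cos(2πxy) dy dx`.

## What is proved

For a test function `g` (`IsWeilTest g`; only `g ∈ L¹` with compact support is used), `Λ > 0`, and ANY
Hilbert basis `b` of the even subspace `evenPart ⊆ L²(ℝ)`:

* `summable_diagCoeff_cutoff` — the diagonal series `Σ_i ⟪b_i, ϑ(f) 𝔽 P_Λ 𝔽⁻¹ P_Λ b_i⟫`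
  (`diagCoeff g (fourierL2 * cutoffProj Λ * fourierL2Inv * cutoffProj Λ) (b i)`) is (absolutely) summable —
  the first conjunct of `Connes1999_thm_VII_4_rat` at `P = ∅`, hypothesis-free;
* `tsum_diagCoeff_cutoff_eq_integral` — its sum is the `Δ`-integral at scale `Λ`:
  `Σ_i ⟪b_i, ϑ(f) 𝔽 P_Λ 𝔽⁻¹ P_Λ b_i⟫ = ∫ g(τ) e^{−τ/2} ∫_{−Λ}^{Λ}∫_{−Λ}^{Λ} cos(2πxv) cos(2π e^{−τ} x v) dx dv dτ`.

Road (a genuinely shorter road than trace-class theory, which Mathlib lacks): the NUCLEAR EXPANSION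
`P_Λ 𝔽⁻¹ P_Λ = Σ_k ((2πi)^k/k!) |u_k⟩⟨u_k|`, `u_k = x^k·1_{[−Λ,Λ]}` (expand `e^{2πixy}` on the square), in
weak form (`hasSum_inner_cutoff_fourierInv_cutoff`); Bessel's inequality along the orthonormal family
`(b_i)` gives absolute summability of the double family; Parseval inside `evenPart` and the vanishing of
`⟪u_k, b_i⟫` for odd `k` (odd against even) leave `Σ_m ((2πi)^{2m}/(2m)!) ⟪u_{2m}, ϑ(f) 𝔽 u_{2m}⟫`, and the
cosine series resums the kernel.
-/

noncomputable section

open _root_.MeasureTheory Complex Set Filter FourierTransform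
open scoped Real Topology ComplexConjugate ENNReal InnerProductSpace Nat

namespace Literature.NumberTheory.Connes2026

open Literature.NumberTheory.LFunctions Literature.NumberTheory.ConnesConsani2021
  Literature.Analysis.FunctionSpaces

/-! ## §1. An abstract summation lemma: diagonal of a nuclear operator along an orthonormal family -/

section Nuclear

variable {E : Type*} [NormedAddCommGroup E] [InnerProductSpace ℂ E]
variable {ι κ : Type*}

/-- Bessel bound for the double family `(i,k) ↦ ‖λ_k‖(‖⟪e_i, p_k⟫‖² + ‖⟪q_k, e_i⟫‖²)`: it is summable as soon
as `Σ_k ‖λ_k‖(‖p_k‖² + ‖q_k‖²) < ∞`, for any orthonormal family `e`. [folklore] -/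
private theorem summable_norm_mul_inner_sq_add {e : ι → E} (he : Orthonormal ℂ e) (p q : κ → E) (lam : κ → ℂ)
    (hsum : Summable fun k => ‖lam k‖ * (‖p k‖ ^ 2 + ‖q k‖ ^ 2)) :
    Summable fun ik : ι × κ => ‖lam ik.2‖ * (‖⟪e ik.1, p ik.2⟫_ℂ‖ ^ 2 + ‖⟪q ik.2, e ik.1⟫_ℂ‖ ^ 2) := by
  classical
  -- work on `κ × ι` first
  have hk : ∀ k, Summable fun i => ‖lam k‖ * (‖⟪e i, p k⟫_ℂ‖ ^ 2 + ‖⟪q k, e i⟫_ℂ‖ ^ 2) := by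
    intro k
    refine ((he.inner_products_summable (x := p k)).add ?_).mul_left _
    have : (fun i => ‖⟪q k, e i⟫_ℂ‖ ^ 2) = fun i => ‖⟪e i, q k⟫_ℂ‖ ^ 2 := by
      funext i; rw [← inner_conj_symm, Complex.norm_conj]
    rw [this]
    exact he.inner_products_summable (x := q k)
  have hle : ∀ k, ∑' i, ‖lam k‖ * (‖⟪e i, p k⟫_ℂ‖ ^ 2 + ‖⟪q k, e i⟫_ℂ‖ ^ 2) ≤
      ‖lam k‖ * (‖p k‖ ^ 2 + ‖q k‖ ^ 2) := by
    intro k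
    have h1 : ∑' i, ‖⟪e i, p k⟫_ℂ‖ ^ 2 ≤ ‖p k‖ ^ 2 := he.tsum_inner_products_le (x := p k)
    have h2 : ∑' i, ‖⟪q k, e i⟫_ℂ‖ ^ 2 ≤ ‖q k‖ ^ 2 := by
      have : (fun i => ‖⟪q k, e i⟫_ℂ‖ ^ 2) = fun i => ‖⟪e i, q k⟫_ℂ‖ ^ 2 := by
        funext i; rw [← inner_conj_symm, Complex.norm_conj]
      rw [this]; exact he.tsum_inner_products_le (x := q k)
    have hs2 : Summable fun i => ‖⟪q k, e i⟫_ℂ‖ ^ 2 := by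
      have : (fun i => ‖⟪q k, e i⟫_ℂ‖ ^ 2) = fun i => ‖⟪e i, q k⟫_ℂ‖ ^ 2 := by
        funext i; rw [← inner_conj_symm, Complex.norm_conj]
      rw [this]; exact he.inner_products_summable (x := q k)
    rw [tsum_mul_left, (he.inner_products_summable (x := p k)).tsum_add hs2]
    exact mul_le_mul_of_nonneg_left (add_le_add h1 h2) (norm_nonneg _)
  have hprod : Summable fun ki : κ × ι =>
      ‖lam ki.1‖ * (‖⟪e ki.2, p ki.1⟫_ℂ‖ ^ 2 + ‖⟪q ki.1, e ki.2⟫_ℂ‖ ^ 2) := by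
    refine (summable_prod_of_nonneg fun ki => by positivity).2 ⟨hk, ?_⟩
    refine Summable.of_nonneg_of_le (fun k => ?_) hle hsum
    exact tsum_nonneg fun i => by positivity
  exact (Equiv.prodComm ι κ).summable_iff.2 hprod |>.congr fun _ => rfl

/-- The double family `(i,k) ↦ λ_k ⟪e_i, p_k⟫ ⟪q_k, e_i⟫` of the diagonal coefficients of the nuclear operator
`Σ_k λ_k |p_k⟩⟨q_k|` along an orthonormal family is absolutely summable. [folklore] -/
private theorem summable_rankOne_diag {e : ι → E} (he : Orthonormal ℂ e) (p q : κ → E) (lam : κ → ℂ)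
    (hsum : Summable fun k => ‖lam k‖ * (‖p k‖ ^ 2 + ‖q k‖ ^ 2)) :
    Summable fun ik : ι × κ => lam ik.2 * (⟪e ik.1, p ik.2⟫_ℂ * ⟪q ik.2, e ik.1⟫_ℂ) := by
  refine Summable.of_norm_bounded (summable_norm_mul_inner_sq_add he p q lam hsum) fun ik => ?_
  rw [norm_mul, norm_mul]
  refine mul_le_mul_of_nonneg_left ?_ (norm_nonneg _)
  nlinarith [sq_nonneg (‖⟪e ik.1, p ik.2⟫_ℂ‖ - ‖⟪q ik.2, e ik.1⟫_ℂ‖), norm_nonneg ⟪e ik.1, p ik.2⟫_ℂ,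
    norm_nonneg ⟪q ik.2, e ik.1⟫_ℂ]

/-- **Diagonal of a nuclear operator, summed along an orthonormal family** (exchange of the two sums):
if `d_i = Σ_k λ_k ⟪e_i, p_k⟫⟪q_k, e_i⟫` for every `i` and `Σ_i ⟪e_i, p_k⟫⟪q_k, e_i⟫ = s_k` for every `k`, then
`Σ_i d_i = Σ_k λ_k s_k` (both absolutely convergent) — the basis-independence bookkeeping of the trace of a
nuclear operator, in series form. [cite: ReedSimon1972, Thm. VI.18 and VI.24 (trace of a trace-class operator along any basis), PDF pp. 196–199] -/
theorem hasSum_rankOne_diag {e : ι → E} (he : Orthonormal ℂ e) (p q : κ → E) (lam : κ → ℂ)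
    (hsum : Summable fun k => ‖lam k‖ * (‖p k‖ ^ 2 + ‖q k‖ ^ 2)) {d : ι → ℂ} {s : κ → ℂ}
    (hd : ∀ i, HasSum (fun k => lam k * (⟪e i, p k⟫_ℂ * ⟪q k, e i⟫_ℂ)) (d i))
    (hs : ∀ k, HasSum (fun i => ⟪e i, p k⟫_ℂ * ⟪q k, e i⟫_ℂ) (s k)) :
    Summable (fun k => lam k * s k) ∧ HasSum d (∑' k, lam k * s k) := by
  have hF := summable_rankOne_diag he p q lam hsum
  set a := ∑' ik : ι × κ, lam ik.2 * (⟪e ik.1, p ik.2⟫_ℂ * ⟪q ik.2, e ik.1⟫_ℂ)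
  have hFa : HasSum (fun ik : ι × κ => lam ik.2 * (⟪e ik.1, p ik.2⟫_ℂ * ⟪q ik.2, e ik.1⟫_ℂ)) a :=
    hF.hasSum
  have hda : HasSum d a := hFa.prod_fiberwise hd
  have hF' : HasSum (fun ki : κ × ι => lam ki.1 * (⟪e ki.2, p ki.1⟫_ℂ * ⟪q ki.1, e ki.2⟫_ℂ)) a :=
    (Equiv.prodComm κ ι).hasSum_iff.2 hFa
  have hsa : HasSum (fun k => lam k * s k) a := hF'.prod_fiberwise fun k => (hs k).mul_left (lam k)
  exact ⟨hsa.summable, hsa.tsum_eq ▸ hda⟩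

end Nuclear

/-! ## §2. The monomial cutoff vectors `u_k = x^k · 1_{[−Λ,Λ]}` -/

/-- `x ↦ x^k 1_{[−Λ,Λ]}(x)` is in `L²(ℝ)` (bounded with bounded support). [folklore] -/
private theorem memLp_monomial_indicator (Λ : ℝ) (k : ℕ) :
    MemLp ((Icc (-Λ) Λ).indicator fun x : ℝ => (x : ℂ) ^ k) 2 (volume : Measure ℝ) := by
  rw [memLp_indicator_iff_restrict measurableSet_Icc]
  refine MemLp.of_bound (Continuous.aestronglyMeasurable (by fun_prop)) (|Λ| ^ k) ?_
  refine (ae_restrict_mem measurableSet_Icc).mono fun x hx => ?_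
  rw [norm_pow, Complex.norm_real, Real.norm_eq_abs]
  exact pow_le_pow_left₀ (abs_nonneg _) (abs_le_abs hx.2 (by linarith [hx.1])) k

/-- `‖u‖² = ∫ ‖u(x)‖² dx` for `u ∈ L²(ℝ)` (plumbing). [folklore] -/
private theorem norm_sq_eq_integral_norm_sq (u : Lp ℂ 2 (volume : Measure ℝ)) :
    ‖u‖ ^ 2 = ∫ x, ‖(u : ℝ → ℂ) x‖ ^ 2 := by
  rw [← inner_self_eq_norm_sq (𝕜 := ℂ), L2.inner_def, ← integral_re (L2.integrable_inner u u)]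
  refine integral_congr_ae (Eventually.of_forall fun x => ?_)
  simp only [RCLike.re_to_complex]
  rw [← inner_self_eq_norm_sq (𝕜 := ℂ)]
  rfl

/-- Norm bound `‖u_k‖² ≤ 2Λ · Λ^{2k}` for `Λ > 0` (`|x^k| ≤ Λ^k` on `[−Λ,Λ]`). [folklore] -/
private theorem norm_sq_monomial_indicator_le {Λ : ℝ} (hΛ : 0 < Λ) (k : ℕ) (u : Lp ℂ 2 (volume : Measure ℝ))
    (hu : (u : ℝ → ℂ) =ᵐ[volume] (Icc (-Λ) Λ).indicator fun x : ℝ => (x : ℂ) ^ k) :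
    ‖u‖ ^ 2 ≤ 2 * Λ * Λ ^ (2 * k) := by
  rw [norm_sq_eq_integral_norm_sq]
  have h1 : (fun x => ‖(u : ℝ → ℂ) x‖ ^ 2) =ᵐ[volume]
      (Icc (-Λ) Λ).indicator fun x : ℝ => ‖(x : ℂ) ^ k‖ ^ 2 := by
    filter_upwards [hu] with x hx
    rw [hx]
    by_cases h : x ∈ Icc (-Λ) Λ
    · rw [indicator_of_mem h, indicator_of_mem h]
    · rw [indicator_of_notMem h, indicator_of_notMem h, norm_zero, zero_pow two_ne_zero]
  rw [integral_congr_ae h1, integral_indicator measurableSet_Icc]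
  have hle : ∀ x ∈ Icc (-Λ) Λ, ‖(x : ℂ) ^ k‖ ^ 2 ≤ Λ ^ (2 * k) := by
    intro x hx
    rw [norm_pow, Complex.norm_real, Real.norm_eq_abs, ← pow_mul, mul_comm]
    exact pow_le_pow_left₀ (abs_nonneg _) (abs_le.2 ⟨by linarith [hx.1], hx.2⟩) _
  calc ∫ x in Icc (-Λ) Λ, ‖(x : ℂ) ^ k‖ ^ 2 ≤ ∫ x in Icc (-Λ) Λ, Λ ^ (2 * k) := by
        refine setIntegral_mono_on ?_ ?_ measurableSet_Icc hle
        · exact (Continuous.integrableOn_Icc (by fun_prop))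
        · exact integrableOn_const (by simp [Real.volume_Icc])
    _ = 2 * Λ * Λ ^ (2 * k) := by
        rw [setIntegral_const, Measure.real, Real.volume_Icc, smul_eq_mul, ENNReal.toReal_ofReal (by linarith)]
        ring

/-! ## §3. Weak form of the nuclear expansion `P_Λ 𝔽⁻¹ P_Λ = Σ_k ((2πi)^k/k!) |u_k⟩⟨u_k|` -/

/-- `fourierL2` is Mathlib's `L²` Fourier transform `𝓕` (definitional). [folklore] -/
private theorem fourierL2_apply (ξ : Lp ℂ 2 (volume : Measure ℝ)) :
    fourierL2 ξ = (𝓕 ξ : Lp ℂ 2 (volume : Measure ℝ)) := rfl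

/-- `fourierL2Inv` is Mathlib's `𝓕⁻` (definitional). [folklore] -/
private theorem fourierL2Inv_apply (ξ : Lp ℂ 2 (volume : Measure ℝ)) :
    fourierL2Inv ξ = (𝓕⁻ ξ : Lp ℂ 2 (volume : Measure ℝ)) := rfl

/-- `⟪x, 𝓕⁻¹ y⟫ = ⟪𝓕 x, y⟫` (unitarity of the `L²` Fourier transform). [folklore] -/
private theorem inner_fourierInv_right (x y : Lp ℂ 2 (volume : Measure ℝ)) :
    ⟪x, (𝓕⁻ y : Lp ℂ 2 (volume : Measure ℝ))⟫_ℂ = ⟪(𝓕 x : Lp ℂ 2 (volume : Measure ℝ)), y⟫_ℂ := by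
  have h := Lp.inner_fourier_eq x (𝓕⁻ y : Lp ℂ 2 (volume : Measure ℝ))
  rw [fourier_fourierInv_eq] at h
  exact h.symm

/-- `⟪𝓕⁻¹ x, y⟫ = ⟪x, 𝓕 y⟫`. [folklore] -/
private theorem inner_fourierInv_left (x y : Lp ℂ 2 (volume : Measure ℝ)) :
    ⟪(𝓕⁻ x : Lp ℂ 2 (volume : Measure ℝ)), y⟫_ℂ = ⟪x, (𝓕 y : Lp ℂ 2 (volume : Measure ℝ))⟫_ℂ := by
  have h := Lp.inner_fourier_eq (𝓕⁻ x : Lp ℂ 2 (volume : Measure ℝ)) y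
  rw [fourier_fourierInv_eq] at h
  exact h.symm

/-- The restriction of an `L²(ℝ)` class to `[−Λ,Λ]` is integrable there (finite measure). [folklore] -/
private theorem integrableOn_Icc_coeFn (Λ : ℝ) (w : Lp ℂ 2 (volume : Measure ℝ)) :
    IntegrableOn (w : ℝ → ℂ) (Icc (-Λ) Λ) := by
  have h2 : MemLp (w : ℝ → ℂ) 2 ((volume : Measure ℝ).restrict (Icc (-Λ) Λ)) :=
    (Lp.memLp w).restrict _
  exact h2.integrable (by norm_num)

/-- `1_{[−Λ,Λ]} w` is integrable on `ℝ`. [folklore] -/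
private theorem integrable_indicator_Icc_coeFn (Λ : ℝ) (w : Lp ℂ 2 (volume : Measure ℝ)) :
    Integrable ((Icc (-Λ) Λ).indicator (w : ℝ → ℂ)) :=
  (integrable_indicator_iff measurableSet_Icc).2 (integrableOn_Icc_coeFn Λ w)

/-- `P_Λ w` is the `L²` class of `1_{[−Λ,Λ]} w` ("`P_Λ` is the multiplication operator by `ρ_Λ = 1_{|x| ≤ Λ}`").
[cite: Connes1999, §VII eq. (12)] -/
theorem cutoffProj_eq_toLp (Λ : ℝ) (w : Lp ℂ 2 (volume : Measure ℝ)) :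
    cutoffProj Λ w =
      ((Lp.memLp w).indicator measurableSet_Icc).toLp ((Icc (-Λ) Λ).indicator (w : ℝ → ℂ)) :=
  Lp.ext ((cutoffProj_coeFn Λ w).trans (MemLp.coeFn_toLp _).symm)

/-- `𝓕 (P_Λ w)` is represented by the Fourier integral of `1_{[−Λ,Λ]} w` (`P_Λ w ∈ L¹ ∩ L²`).
[cite: Connes1999, §VII eq. (12) and Lemma 1 b)] -/
theorem fourier_cutoffProj_coeFn (Λ : ℝ) (w : Lp ℂ 2 (volume : Measure ℝ)) :
    ((𝓕 (cutoffProj Λ w) : Lp ℂ 2 (volume : Measure ℝ)) : ℝ → ℂ) =ᵐ[volume]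
      𝓕 ((Icc (-Λ) Λ).indicator (w : ℝ → ℂ)) := by
  rw [cutoffProj_eq_toLp]
  exact fourier_toLp_ae_eq_fourierIntegral (integrable_indicator_Icc_coeFn Λ w) _

/-- The Fourier integral of `1_{[−Λ,Λ]} w` at `y`: `∫_{−Λ}^{Λ} e^{−2πivy} w(v) dv`. [folklore] -/
private theorem fourierIntegral_indicator_Icc (Λ : ℝ) (w : ℝ → ℂ) (y : ℝ) :
    𝓕 ((Icc (-Λ) Λ).indicator w) y = ∫ v in Icc (-Λ) Λ, cexp (-(2 * π * v * y * I)) * w v := by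
  rw [Real.fourier_eq', ← integral_indicator (measurableSet_Icc : MeasurableSet (Icc (-Λ) Λ))]
  refine integral_congr_ae (Eventually.of_forall fun v => ?_)
  simp only [smul_eq_mul, RCLike.inner_apply, conj_trivial]
  by_cases hv : v ∈ Icc (-Λ) Λ
  · rw [indicator_of_mem hv, indicator_of_mem hv]
    congr 1
    push_cast
    ring_nf
  · simp [indicator_of_notMem hv]

/-- **`⟪w, P_Λ 𝔽⁻¹ P_Λ e⟫` as a double integral over the square**:
`∫_{−Λ}^{Λ} (∫_{−Λ}^{Λ} e^{2πivy} conj(w(v)) dv) e(y) dy` (the Schwartz kernel `e^{2πivy}1_{[−Λ,Λ]²}` of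
`P_Λ 𝔽⁻¹ P_Λ`). [cite: Connes1999, §V eqs. (15)–(16) and §VII eq. (13) (the cutoffs P_Λ, P̂_Λ, R_Λ)] -/
theorem inner_cutoff_fourierInv_cutoff_eq_integral (Λ : ℝ) (w e : Lp ℂ 2 (volume : Measure ℝ)) :
    ⟪w, cutoffProj Λ (fourierL2Inv (cutoffProj Λ e))⟫_ℂ =
      ∫ y in Icc (-Λ) Λ, (∫ v in Icc (-Λ) Λ, cexp (2 * π * v * y * I) * conj ((w : ℝ → ℂ) v)) *
        (e : ℝ → ℂ) y := by
  rw [← inner_cutoffProj_left, fourierL2Inv_apply, inner_fourierInv_right, L2.inner_def,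
    ← integral_indicator measurableSet_Icc]
  refine integral_congr_ae ?_
  filter_upwards [fourier_cutoffProj_coeFn Λ w, cutoffProj_coeFn Λ e] with y h1 h2
  rw [h1, h2, RCLike.inner_apply, fourierIntegral_indicator_Icc, ← integral_conj]
  by_cases hy : y ∈ Icc (-Λ) Λ
  · rw [indicator_of_mem hy, indicator_of_mem hy, mul_comm]
    congr 1
    refine setIntegral_congr_fun measurableSet_Icc fun v _ => ?_
    rw [map_mul, ← Complex.exp_conj]
    congr 2
    simp only [map_neg, map_mul, Complex.conj_ofReal, Complex.conj_I, map_ofNat]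
    ring
  · simp [indicator_of_notMem hy]

/-- `⟪w, u_k⟫ = ∫_{−Λ}^{Λ} v^k conj(w(v)) dv`. [folklore] -/
private theorem inner_monomial_right {Λ : ℝ} {k : ℕ} (u : Lp ℂ 2 (volume : Measure ℝ))
    (hu : (u : ℝ → ℂ) =ᵐ[volume] (Icc (-Λ) Λ).indicator fun x : ℝ => (x : ℂ) ^ k)
    (w : Lp ℂ 2 (volume : Measure ℝ)) :
    ⟪w, u⟫_ℂ = ∫ v in Icc (-Λ) Λ, (v : ℂ) ^ k * conj ((w : ℝ → ℂ) v) := by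
  rw [L2.inner_def, ← integral_indicator measurableSet_Icc]
  refine integral_congr_ae ?_
  filter_upwards [hu] with v hv
  rw [hv, RCLike.inner_apply]
  by_cases h : v ∈ Icc (-Λ) Λ
  · rw [indicator_of_mem h, indicator_of_mem h]
  · simp [indicator_of_notMem h]

/-- `⟪u_k, e⟫ = ∫_{−Λ}^{Λ} y^k e(y) dy`. [folklore] -/
private theorem inner_monomial_left {Λ : ℝ} {k : ℕ} (u : Lp ℂ 2 (volume : Measure ℝ))
    (hu : (u : ℝ → ℂ) =ᵐ[volume] (Icc (-Λ) Λ).indicator fun x : ℝ => (x : ℂ) ^ k)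
    (e : Lp ℂ 2 (volume : Measure ℝ)) :
    ⟪u, e⟫_ℂ = ∫ y in Icc (-Λ) Λ, (y : ℂ) ^ k * (e : ℝ → ℂ) y := by
  rw [L2.inner_def, ← integral_indicator measurableSet_Icc]
  refine integral_congr_ae ?_
  filter_upwards [hu] with y hy
  rw [hy, RCLike.inner_apply]
  by_cases h : y ∈ Icc (-Λ) Λ
  · rw [indicator_of_mem h, indicator_of_mem h, map_pow, Complex.conj_ofReal, mul_comm]
  · simp [indicator_of_notMem h]

/-- On `[−Λ,Λ]`, `‖(x : ℂ)^k‖ ≤ Λ^k`. [folklore] -/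
private theorem norm_ofReal_pow_le {Λ x : ℝ} (hx : x ∈ Icc (-Λ) Λ) (k : ℕ) : ‖(x : ℂ) ^ k‖ ≤ Λ ^ k := by
  rw [norm_pow, Complex.norm_real, Real.norm_eq_abs]
  exact pow_le_pow_left₀ (abs_nonneg _) (abs_le.2 ⟨by linarith [hx.1], hx.2⟩) _

/-- `‖(2πi)^k / k!‖ = (2π)^k / k!`. [folklore] -/
private theorem norm_twoPiI_pow_div_factorial (k : ℕ) :
    ‖(2 * π * I) ^ k / (k ! : ℂ)‖ = (2 * π) ^ k / k ! := by
  rw [norm_div, norm_pow, Complex.norm_natCast]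
  congr 1
  rw [norm_mul, Complex.norm_I, mul_one, norm_mul, Complex.norm_two, Complex.norm_real,
    Real.norm_eq_abs, abs_of_pos Real.pi_pos]

/-- **Weak form of the nuclear expansion of `P_Λ 𝔽⁻¹ P_Λ`**: for `w, e ∈ L²(ℝ)`,
`⟪w, P_Λ 𝔽⁻¹ P_Λ e⟫ = Σ_k ((2πi)^k/k!) ⟪w, u_k⟫ ⟪u_k, e⟫`, `u_k = x^k · 1_{[−Λ,Λ]}` (expand `e^{2πivy}` on
the square `[−Λ,Λ]²` and integrate termwise — dominated by `e^{2πΛ²}|w(v)||e(y)|`); our device replacing the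
trace-class theory of `R_Λ = P̂_Λ P_Λ` used in print. [cite: Connes1999, §V eqs. (15)–(16) and §VII eq. (13) (R_Λ = P̂_Λ P_Λ)] -/
theorem hasSum_inner_cutoff_fourierInv_cutoff {Λ : ℝ} (hΛ : 0 < Λ)
    (u : ℕ → Lp ℂ 2 (volume : Measure ℝ))
    (hu : ∀ k, (u k : ℝ → ℂ) =ᵐ[volume] (Icc (-Λ) Λ).indicator fun x : ℝ => (x : ℂ) ^ k)
    (w e : Lp ℂ 2 (volume : Measure ℝ)) :
    HasSum (fun k : ℕ => (2 * π * I) ^ k / (k ! : ℂ) * (⟪w, u k⟫_ℂ * ⟪u k, e⟫_ℂ))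
      ⟪w, cutoffProj Λ (fourierL2Inv (cutoffProj Λ e))⟫_ℂ := by
  rw [inner_cutoff_fourierInv_cutoff_eq_integral]
  set μ : Measure ℝ := (volume : Measure ℝ).restrict (Icc (-Λ) Λ) with hμ
  haveI : IsFiniteMeasure μ := by rw [hμ]; infer_instance
  have hw : Integrable (fun v => (w : ℝ → ℂ) v) μ := integrableOn_Icc_coeFn Λ w
  have he : Integrable (fun y => (e : ℝ → ℂ) y) μ := integrableOn_Icc_coeFn Λ e
  have hae : ∀ᵐ x ∂μ, x ∈ Icc (-Λ) Λ := ae_restrict_mem measurableSet_Icc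
  -- the coefficients `A_k = ∫ v^k conj(w)`.
  set A : ℕ → ℂ := fun k => ∫ v in Icc (-Λ) Λ, (v : ℂ) ^ k * conj ((w : ℝ → ℂ) v) with hA
  set c : ℕ → ℂ := fun k => (2 * π * I) ^ k / (k ! : ℂ) with hc
  have hc_norm : ∀ k, ‖c k‖ = (2 * π) ^ k / k ! := norm_twoPiI_pow_div_factorial
  have hA_le : ∀ k, ‖A k‖ ≤ Λ ^ k * ∫ v in Icc (-Λ) Λ, ‖(w : ℝ → ℂ) v‖ := by
    intro k
    rw [hA]
    dsimp only
    rw [← integral_const_mul]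
    refine norm_integral_le_of_norm_le (hw.norm.const_mul _) ?_
    filter_upwards [hae] with v hv
    rw [norm_mul, RCLike.norm_conj]
    exact mul_le_mul_of_nonneg_right (norm_ofReal_pow_le hv k) (norm_nonneg _)
  -- INNER termwise integration: for every `y ∈ [−Λ,Λ]`.
  have inner_sum : ∀ y ∈ Icc (-Λ) Λ,
      HasSum (fun k => c k * (y : ℂ) ^ k * A k)
        (∫ v in Icc (-Λ) Λ, cexp (2 * π * v * y * I) * conj ((w : ℝ → ℂ) v)) := by
    intro y hy
    have hAk : ∀ k, c k * (y : ℂ) ^ k * A k =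
        ∫ v in Icc (-Λ) Λ, c k * (y : ℂ) ^ k * ((v : ℂ) ^ k * conj ((w : ℝ → ℂ) v)) := by
      intro k; rw [integral_const_mul]
    simp_rw [hAk]
    have hexp : ∀ v : ℝ, HasSum (fun k => c k * (y : ℂ) ^ k * ((v : ℂ) ^ k * conj ((w : ℝ → ℂ) v)))
        (cexp (2 * π * v * y * I) * conj ((w : ℝ → ℂ) v)) := by
      intro v
      have h0 := (NormedSpace.expSeries_div_hasSum_exp (2 * π * v * y * I : ℂ)).mul_right
        (conj ((w : ℝ → ℂ) v))
      rw [← congrFun Complex.exp_eq_exp_ℂ (2 * π * v * y * I)] at h0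
      have hfun : (fun k => c k * (y : ℂ) ^ k * ((v : ℂ) ^ k * conj ((w : ℝ → ℂ) v))) =
          fun i => (2 * π * v * y * I : ℂ) ^ i / (i ! : ℂ) * conj ((w : ℝ → ℂ) v) := by
        funext k
        rw [hc]
        dsimp only
        rw [mul_pow, mul_pow, mul_pow, mul_pow, mul_pow]
        ring
      rw [hfun]
      exact h0
    refine hasSum_integral_of_dominated_convergence
      (fun k v => (2 * π * Λ ^ 2) ^ k / k ! * ‖(w : ℝ → ℂ) v‖) (fun k => ?_) (fun k => ?_) ?_ ?_
      (Eventually.of_forall hexp)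
    · exact ((Continuous.aestronglyMeasurable (by fun_prop)).mul
        (Complex.continuous_conj.comp_aestronglyMeasurable hw.aestronglyMeasurable)).const_mul _
    · filter_upwards [hae] with v hv
      rw [norm_mul, norm_mul, norm_mul, RCLike.norm_conj, hc_norm]
      have h1 := norm_ofReal_pow_le hy k
      have h2 := norm_ofReal_pow_le hv k
      have h3 : (0 : ℝ) ≤ (2 * π) ^ k / k ! := by positivity
      calc (2 * π) ^ k / ↑k ! * ‖(y : ℂ) ^ k‖ * (‖(v : ℂ) ^ k‖ * ‖(w : ℝ → ℂ) v‖)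
          ≤ (2 * π) ^ k / ↑k ! * Λ ^ k * (Λ ^ k * ‖(w : ℝ → ℂ) v‖) := by
            gcongr
        _ = (2 * π * Λ ^ 2) ^ k / ↑k ! * ‖(w : ℝ → ℂ) v‖ := by ring
    · exact Eventually.of_forall fun v => (Real.summable_pow_div_factorial _).mul_right _
    · have : (fun v => ∑' k, (2 * π * Λ ^ 2) ^ k / k ! * ‖(w : ℝ → ℂ) v‖) =
          fun v => (∑' k : ℕ, (2 * π * Λ ^ 2) ^ k / k !) * ‖(w : ℝ → ℂ) v‖ := by
        funext v; rw [tsum_mul_right]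
      rw [this]
      exact hw.norm.const_mul _
  -- OUTER termwise integration over `y ∈ [−Λ,Λ]`.
  set W : ℝ := ∫ v in Icc (-Λ) Λ, ‖(w : ℝ → ℂ) v‖ with hW
  have hterm : ∀ k, (2 * π * I) ^ k / (k ! : ℂ) * (⟪w, u k⟫_ℂ * ⟪u k, e⟫_ℂ) =
      ∫ y in Icc (-Λ) Λ, c k * (y : ℂ) ^ k * A k * (e : ℝ → ℂ) y := by
    intro k
    rw [inner_monomial_right (u k) (hu k) w, inner_monomial_left (u k) (hu k) e, ← mul_assoc,
      ← integral_const_mul]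
    refine setIntegral_congr_fun measurableSet_Icc fun y _ => ?_
    rw [hc, hA]
    ring
  simp_rw [hterm]
  refine hasSum_integral_of_dominated_convergence
    (fun k y => (2 * π * Λ ^ 2) ^ k / k ! * W * ‖(e : ℝ → ℂ) y‖) (fun k => ?_) (fun k => ?_) ?_ ?_ ?_
  · exact (Continuous.aestronglyMeasurable (by fun_prop)).mul he.aestronglyMeasurable
  · filter_upwards [hae] with y hy
    rw [norm_mul, norm_mul, norm_mul, hc_norm]
    have h1 := norm_ofReal_pow_le hy k
    have h2 := hA_le k
    have hW0 : 0 ≤ W := integral_nonneg fun v => norm_nonneg _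
    have h3 : (0 : ℝ) ≤ (2 * π) ^ k / k ! := by positivity
    calc (2 * π) ^ k / ↑k ! * ‖(y : ℂ) ^ k‖ * ‖A k‖ * ‖(e : ℝ → ℂ) y‖
        ≤ (2 * π) ^ k / ↑k ! * Λ ^ k * (Λ ^ k * W) * ‖(e : ℝ → ℂ) y‖ := by gcongr
      _ = (2 * π * Λ ^ 2) ^ k / ↑k ! * W * ‖(e : ℝ → ℂ) y‖ := by ring
  · exact Eventually.of_forall fun y => ((Real.summable_pow_div_factorial _).mul_right _).mul_right _
  · have : (fun y => ∑' k, (2 * π * Λ ^ 2) ^ k / k ! * W * ‖(e : ℝ → ℂ) y‖) =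
        fun y => ((∑' k : ℕ, (2 * π * Λ ^ 2) ^ k / k !) * W) * ‖(e : ℝ → ℂ) y‖ := by
      funext y; rw [tsum_mul_right, tsum_mul_right]
    rw [this]
    exact he.norm.const_mul _
  · filter_upwards [hae] with y hy
    exact (inner_sum y hy).mul_right _

/-! ## §4. The diagonal coefficient as a nuclear series; parity -/

/-- **`⟪e, ϑ(f) 𝔽 P_Λ 𝔽⁻¹ P_Λ e⟫ = Σ_k ((2πi)^k/k!) ⟪e, ϑ(f) 𝔽 u_k⟫ ⟪u_k, e⟫`** (move `ϑ(f) 𝔽` to the left as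
`𝔽⁻¹ ϑ(f)†` and expand `P_Λ 𝔽⁻¹ P_Λ`). [cite: Connes1999, §V Thm 3 and §VII Thm 4 (proof structure); Connes2026Letter, §7.1] -/
theorem hasSum_diagCoeff_cutoff {Λ : ℝ} (hΛ : 0 < Λ) (g : ℝ → ℂ)
    (u : ℕ → Lp ℂ 2 (volume : Measure ℝ))
    (hu : ∀ k, (u k : ℝ → ℂ) =ᵐ[volume] (Icc (-Λ) Λ).indicator fun x : ℝ => (x : ℂ) ^ k)
    (e : Lp ℂ 2 (volume : Measure ℝ)) :
    HasSum (fun k : ℕ => (2 * π * I) ^ k / (k ! : ℂ) *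
        (⟪e, scalingOp g ((𝓕 (u k) : Lp ℂ 2 (volume : Measure ℝ)))⟫_ℂ * ⟪u k, e⟫_ℂ))
      (diagCoeff g (fourierL2 * cutoffProj Λ * fourierL2Inv * cutoffProj Λ) e) := by
  have h1 : diagCoeff g (fourierL2 * cutoffProj Λ * fourierL2Inv * cutoffProj Λ) e =
      ⟪(𝓕⁻ (ContinuousLinearMap.adjoint (scalingOp g) e) : Lp ℂ 2 (volume : Measure ℝ)),
        cutoffProj Λ (fourierL2Inv (cutoffProj Λ e))⟫_ℂ := by
    rw [diagCoeff]
    simp only [ContinuousLinearMap.mul_def, ContinuousLinearMap.coe_comp, Function.comp_apply]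
    rw [fourierL2_apply, ← ContinuousLinearMap.adjoint_inner_left, inner_fourierInv_left]
  rw [h1]
  have h2 := hasSum_inner_cutoff_fourierInv_cutoff hΛ u hu
    (𝓕⁻ (ContinuousLinearMap.adjoint (scalingOp g) e) : Lp ℂ 2 (volume : Measure ℝ)) e
  refine h2.congr_fun fun k => ?_
  rw [inner_fourierInv_left, ContinuousLinearMap.adjoint_inner_left]

/-- For ODD `k`, `u_k` is orthogonal to every even `e`: `⟪u_k, e⟫ = 0` (odd against even on `[−Λ,Λ]`).
[folklore] -/
private theorem inner_monomial_eq_zero_of_odd {Λ : ℝ} {k : ℕ} (hk : Odd k) (u : Lp ℂ 2 (volume : Measure ℝ))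
    (hu : (u : ℝ → ℂ) =ᵐ[volume] (Icc (-Λ) Λ).indicator fun x : ℝ => (x : ℂ) ^ k)
    {e : Lp ℂ 2 (volume : Measure ℝ)} (he : e ∈ evenPart) : ⟪u, e⟫_ℂ = 0 := by
  rw [mem_evenPart_iff] at he
  rw [inner_monomial_left u hu e, ← integral_indicator measurableSet_Icc]
  set f : ℝ → ℂ := (Icc (-Λ) Λ).indicator fun y : ℝ => (y : ℂ) ^ k * (e : ℝ → ℂ) y with hf
  have hneg : (fun y => f (-y)) =ᵐ[volume] fun y => -f y := by
    filter_upwards [he] with y hy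
    change (Icc (-Λ) Λ).indicator (fun y : ℝ => (y : ℂ) ^ k * (e : ℝ → ℂ) y) (-y) =
      -((Icc (-Λ) Λ).indicator (fun y : ℝ => (y : ℂ) ^ k * (e : ℝ → ℂ) y) y)
    have hmem : (-y ∈ Icc (-Λ) Λ) ↔ (y ∈ Icc (-Λ) Λ) := by
      simp only [mem_Icc]; constructor <;> rintro ⟨h1, h2⟩ <;> constructor <;> linarith
    by_cases h : y ∈ Icc (-Λ) Λ
    · rw [indicator_of_mem (hmem.2 h), indicator_of_mem h, hy, Complex.ofReal_neg, hk.neg_pow]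
      ring
    · rw [indicator_of_notMem (fun h' => h (hmem.1 h')), indicator_of_notMem h, neg_zero]
  have h1 : ∫ y, f y = ∫ y, f (-y) := (integral_neg_eq_self f volume).symm
  rw [integral_congr_ae hneg, integral_neg] at h1
  have : (2 : ℂ) * ∫ y, f y = 0 := by rw [two_mul]; nth_rw 2 [h1]; ring
  simpa using this

/-- For EVEN `k`, `u_k ∈ L²(ℝ)_ev`. [folklore] -/
private theorem monomial_mem_evenPart_of_even {Λ : ℝ} {k : ℕ} (hk : Even k) (u : Lp ℂ 2 (volume : Measure ℝ))
    (hu : (u : ℝ → ℂ) =ᵐ[volume] (Icc (-Λ) Λ).indicator fun x : ℝ => (x : ℂ) ^ k) :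
    u ∈ evenPart := by
  rw [mem_evenPart_iff]
  have h1 : (fun x => (u : ℝ → ℂ) (-x)) =ᵐ[volume] fun x => (Icc (-Λ) Λ).indicator
      (fun x : ℝ => (x : ℂ) ^ k) (-x) :=
    (Measure.measurePreserving_neg (volume : Measure ℝ)).quasiMeasurePreserving.ae_eq_comp hu
  filter_upwards [hu, h1] with x hx hx'
  rw [hx, hx']
  have hmem : (-x ∈ Icc (-Λ) Λ) ↔ (x ∈ Icc (-Λ) Λ) := by
    simp only [mem_Icc]; constructor <;> rintro ⟨h1, h2⟩ <;> constructor <;> linarith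
  by_cases h : x ∈ Icc (-Λ) Λ
  · rw [indicator_of_mem (hmem.2 h), indicator_of_mem h, Complex.ofReal_neg, hk.neg_pow]
  · rw [indicator_of_notMem (fun h' => h (hmem.1 h')), indicator_of_notMem h]

/-- **Parseval inside `L²(ℝ)_ev`**: for `x ∈ evenPart`, any `y ∈ L²(ℝ)`, and a Hilbert basis `b` of
`evenPart`, `Σ_i ⟪x, b_i⟫ ⟪b_i, y⟫ = ⟪x, y⟫` (only `x` needs to be even). [folklore] -/
private theorem hasSum_inner_mul_inner_evenPart {ι : Type*} (b : HilbertBasis ι ℂ evenPart)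
    {x : Lp ℂ 2 (volume : Measure ℝ)} (hx : x ∈ evenPart) (y : Lp ℂ 2 (volume : Measure ℝ)) :
    HasSum (fun i => ⟪((b i : evenPart) : Lp ℂ 2 (volume : Measure ℝ)), y⟫_ℂ *
      ⟪x, ((b i : evenPart) : Lp ℂ 2 (volume : Measure ℝ))⟫_ℂ) ⟪x, y⟫_ℂ := by
  set x' : evenPart := ⟨x, hx⟩ with hx'
  -- expansion of `x` along `b`, read in `L²(ℝ)`
  have h1 : HasSum (fun i => (b.repr x' i) • ((b i : evenPart) : Lp ℂ 2 (volume : Measure ℝ))) x := by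
    have h := (b.hasSum_repr x').mapL evenPart.subtypeL
    simpa using h
  -- pair with `y` on the right: `i ↦ ⟪y, ·⟫` is continuous linear, then conjugate
  have h2 : HasSum (fun i => ⟪y, (b.repr x' i) • ((b i : evenPart) : Lp ℂ 2 (volume : Measure ℝ))⟫_ℂ)
      ⟪y, x⟫_ℂ := by
    simpa only [innerSL_apply_apply] using h1.mapL (innerSL ℂ y)
  have h3 := Complex.hasSum_conj'.2 h2
  rw [inner_conj_symm] at h3
  refine h3.congr_fun fun i => ?_
  rw [inner_smul_right, map_mul, inner_conj_symm, b.repr_apply_apply, Submodule.coe_inner,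
    inner_conj_symm, mul_comm]

/-- Along a Hilbert basis `b` of `L²(ℝ)_ev`, `Σ_i ⟪b_i, y⟫ ⟪u_k, b_i⟫` is `⟪u_k, y⟫` for even `k` and `0`
for odd `k`. [folklore] -/
private theorem hasSum_basis_monomial {ι : Type*} (b : HilbertBasis ι ℂ evenPart) {Λ : ℝ} {k : ℕ}
    (u : Lp ℂ 2 (volume : Measure ℝ))
    (hu : (u : ℝ → ℂ) =ᵐ[volume] (Icc (-Λ) Λ).indicator fun x : ℝ => (x : ℂ) ^ k)
    (y : Lp ℂ 2 (volume : Measure ℝ)) :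
    HasSum (fun i => ⟪((b i : evenPart) : Lp ℂ 2 (volume : Measure ℝ)), y⟫_ℂ *
      ⟪u, ((b i : evenPart) : Lp ℂ 2 (volume : Measure ℝ))⟫_ℂ)
      (if Even k then ⟪u, y⟫_ℂ else 0) := by
  rcases Nat.even_or_odd k with hk | hk
  · rw [if_pos hk]
    exact hasSum_inner_mul_inner_evenPart b (monomial_mem_evenPart_of_even hk u hu) y
  · rw [if_neg (Nat.not_even_iff_odd.2 hk)]
    have : (fun i => ⟪((b i : evenPart) : Lp ℂ 2 (volume : Measure ℝ)), y⟫_ℂ *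
        ⟪u, ((b i : evenPart) : Lp ℂ 2 (volume : Measure ℝ))⟫_ℂ) = fun _ => 0 := by
      funext i
      rw [inner_monomial_eq_zero_of_odd hk u hu (Submodule.coe_mem (b i)), mul_zero]
    rw [this]
    exact hasSum_zero

/-! ## §5. Summability of the diagonal series and its value as a series over even monomials -/

/-- The Hilbert basis of `evenPart`, read in `L²(ℝ)`, is an orthonormal family. [folklore] -/
private theorem orthonormal_coe_hilbertBasis_evenPart {ι : Type*} (b : HilbertBasis ι ℂ evenPart) :
    Orthonormal ℂ fun i => ((b i : evenPart) : Lp ℂ 2 (volume : Measure ℝ)) :=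
  (evenPart.subtypeₗᵢ.orthonormal_comp_iff).2 b.orthonormal

/-- The nuclear weights are summable: `Σ_k ((2π)^k/k!) (‖ϑ(f)𝔽u_k‖² + ‖u_k‖²) < ∞`
(`‖u_k‖² ≤ 2Λ·Λ^{2k}`, `‖ϑ(f)‖ ≤ ‖g‖₁`, `𝔽` isometric). [folklore] -/
private theorem summable_nuclear_weights {g : ℝ → ℂ} (hg : Integrable g) {Λ : ℝ} (hΛ : 0 < Λ)
    (u : ℕ → Lp ℂ 2 (volume : Measure ℝ))
    (hu : ∀ k, (u k : ℝ → ℂ) =ᵐ[volume] (Icc (-Λ) Λ).indicator fun x : ℝ => (x : ℂ) ^ k) :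
    Summable fun k : ℕ => ‖(2 * π * I) ^ k / (k ! : ℂ)‖ *
      (‖scalingOp g ((𝓕 (u k) : Lp ℂ 2 (volume : Measure ℝ)))‖ ^ 2 + ‖u k‖ ^ 2) := by
  set G : ℝ := ∫ τ, ‖g τ‖ with hG
  have hG0 : 0 ≤ G := integral_nonneg fun τ => norm_nonneg _
  have hle : ∀ k, ‖(2 * π * I) ^ k / (k ! : ℂ)‖ *
      (‖scalingOp g ((𝓕 (u k) : Lp ℂ 2 (volume : Measure ℝ)))‖ ^ 2 + ‖u k‖ ^ 2) ≤
      (G ^ 2 + 1) * (2 * Λ) * ((2 * π * Λ ^ 2) ^ k / k !) := by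
    intro k
    rw [norm_twoPiI_pow_div_factorial]
    have h1 : ‖scalingOp g ((𝓕 (u k) : Lp ℂ 2 (volume : Measure ℝ)))‖ ≤ G * ‖u k‖ := by
      refine (norm_scalingOp_apply_le hg _).trans ?_
      rw [Lp.norm_fourier_eq]
    have h2 := norm_sq_monomial_indicator_le hΛ k (u k) (hu k)
    have h3 : ‖scalingOp g ((𝓕 (u k) : Lp ℂ 2 (volume : Measure ℝ)))‖ ^ 2 ≤ G ^ 2 * ‖u k‖ ^ 2 := by
      rw [← mul_pow]
      exact pow_le_pow_left₀ (norm_nonneg _) h1 2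
    have h4 : (0 : ℝ) ≤ (2 * π) ^ k / k ! := by positivity
    calc (2 * π) ^ k / ↑k ! * (‖scalingOp g ((𝓕 (u k) : Lp ℂ 2 (volume : Measure ℝ)))‖ ^ 2 + ‖u k‖ ^ 2)
        ≤ (2 * π) ^ k / ↑k ! * (G ^ 2 * ‖u k‖ ^ 2 + ‖u k‖ ^ 2) := by gcongr
      _ = (2 * π) ^ k / ↑k ! * ((G ^ 2 + 1) * ‖u k‖ ^ 2) := by ring
      _ ≤ (2 * π) ^ k / ↑k ! * ((G ^ 2 + 1) * (2 * Λ * Λ ^ (2 * k))) := by gcongr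
      _ = (G ^ 2 + 1) * (2 * Λ) * ((2 * π * Λ ^ 2) ^ k / k !) := by ring
  refine Summable.of_nonneg_of_le (fun k => by positivity) hle ?_
  exact (Real.summable_pow_div_factorial _).mul_left _

/-- **The diagonal series is absolutely summable along any Hilbert basis of `L²(ℝ)_ev`, and equals the
series over EVEN monomials `Σ_m ((2πi)^{2m}/(2m)!) ⟪u_{2m}, ϑ(f) 𝔽 u_{2m}⟫`** (exchange of sums by Bessel;
Parseval in `evenPart`; odd monomials drop out). [cite: Connes1999, §V Thm 3 (K = ℝ); Connes2026Letter, §7.1] -/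
theorem hasSum_even_monomial_diagCoeff_cutoff {g : ℝ → ℂ} (hg : Integrable g) {Λ : ℝ} (hΛ : 0 < Λ)
    {ι : Type*} (b : HilbertBasis ι ℂ evenPart) (u : ℕ → Lp ℂ 2 (volume : Measure ℝ))
    (hu : ∀ k, (u k : ℝ → ℂ) =ᵐ[volume] (Icc (-Λ) Λ).indicator fun x : ℝ => (x : ℂ) ^ k) :
    Summable (fun i => diagCoeff g (fourierL2 * cutoffProj Λ * fourierL2Inv * cutoffProj Λ)
        ((b i : evenPart) : Lp ℂ 2 (volume : Measure ℝ))) ∧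
    HasSum (fun m : ℕ => (2 * π * I) ^ (2 * m) / ((2 * m) ! : ℂ) *
        ⟪u (2 * m), scalingOp g ((𝓕 (u (2 * m)) : Lp ℂ 2 (volume : Measure ℝ)))⟫_ℂ)
      (∑' i, diagCoeff g (fourierL2 * cutoffProj Λ * fourierL2Inv * cutoffProj Λ)
        ((b i : evenPart) : Lp ℂ 2 (volume : Measure ℝ))) := by
  set e : ι → Lp ℂ 2 (volume : Measure ℝ) := fun i => ((b i : evenPart) : Lp ℂ 2 (volume : Measure ℝ))
    with he_def
  have he : Orthonormal ℂ e := orthonormal_coe_hilbertBasis_evenPart b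
  set p : ℕ → Lp ℂ 2 (volume : Measure ℝ) := fun k => scalingOp g ((𝓕 (u k) : Lp ℂ 2 (volume : Measure ℝ)))
    with hp
  set lam : ℕ → ℂ := fun k => (2 * π * I) ^ k / (k ! : ℂ) with hlam
  set s : ℕ → ℂ := fun k => if Even k then ⟪u k, p k⟫_ℂ else 0 with hs_def
  have hsum : Summable fun k => ‖lam k‖ * (‖p k‖ ^ 2 + ‖u k‖ ^ 2) := summable_nuclear_weights hg hΛ u hu
  have hd : ∀ i, HasSum (fun k => lam k * (⟪e i, p k⟫_ℂ * ⟪u k, e i⟫_ℂ))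
      (diagCoeff g (fourierL2 * cutoffProj Λ * fourierL2Inv * cutoffProj Λ) (e i)) :=
    fun i => hasSum_diagCoeff_cutoff hΛ g u hu (e i)
  have hs : ∀ k, HasSum (fun i => ⟪e i, p k⟫_ℂ * ⟪u k, e i⟫_ℂ) (s k) :=
    fun k => hasSum_basis_monomial b (u k) (hu k) (p k)
  obtain ⟨h1, h2⟩ := hasSum_rankOne_diag he p u lam hsum hd hs
  refine ⟨h2.summable, ?_⟩
  rw [h2.tsum_eq]
  -- drop the odd terms: reindex `k = 2m`
  have h3 : HasSum (fun k => lam k * s k) (∑' k, lam k * s k) := h1.hasSum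
  have hinj : Function.Injective fun m : ℕ => 2 * m := fun a b h => by simpa using h
  have hzero : ∀ k ∉ Set.range (fun m : ℕ => 2 * m), lam k * s k = 0 := by
    intro k hk
    have hodd : ¬ Even k := fun ⟨m, hm⟩ => hk ⟨m, by simp only; omega⟩
    rw [hs_def]
    dsimp only
    rw [if_neg hodd, mul_zero]
  have h4 := (hinj.hasSum_iff hzero).2 h3
  refine h4.congr_fun fun m => ?_
  simp only [Function.comp_apply, hlam, hs_def, hp]
  rw [if_pos (even_two_mul m)]

/-! ## §6. Kernel evaluation of `⟪u_k, ϑ(f) 𝔽 u_k⟫` and resummation of the cosine series -/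

/-- The monomial cutoff `x^k 1_{[−Λ,Λ]}` is integrable. [folklore] -/
private theorem integrable_monomial_indicator (Λ : ℝ) (k : ℕ) :
    Integrable ((Icc (-Λ) Λ).indicator fun x : ℝ => (x : ℂ) ^ k) :=
  (integrable_indicator_iff measurableSet_Icc).2 (Continuous.integrableOn_Icc (by fun_prop))

/-- Bound `|𝓕(x^k 1_{[−Λ,Λ]})(y)| ≤ 2Λ·Λ^k` (`Λ > 0`). [folklore] -/
private theorem norm_fourierIntegral_monomial_le {Λ : ℝ} (hΛ : 0 < Λ) (k : ℕ) (y : ℝ) :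
    ‖𝓕 ((Icc (-Λ) Λ).indicator fun x : ℝ => (x : ℂ) ^ k) y‖ ≤ 2 * Λ * Λ ^ k := by
  rw [fourierIntegral_indicator_Icc]
  have h1 : ∀ x ∈ Icc (-Λ) Λ, ‖cexp (-(2 * π * x * y * I)) * (x : ℂ) ^ k‖ ≤ Λ ^ k := by
    intro x hx
    rw [norm_mul, Complex.norm_exp]
    have : (-(2 * π * (x : ℂ) * y * I)).re = 0 := by
      simp [Complex.mul_re, Complex.mul_im, Complex.I_re, Complex.I_im]
    rw [this, Real.exp_zero, one_mul]
    exact norm_ofReal_pow_le hx k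
  calc ‖∫ x in Icc (-Λ) Λ, cexp (-(2 * π * x * y * I)) * (x : ℂ) ^ k‖
      ≤ Λ ^ k * ((volume : Measure ℝ) (Icc (-Λ) Λ)).toReal :=
        norm_setIntegral_le_of_norm_le_const (by simp [Real.volume_Icc]) h1
    _ = 2 * Λ * Λ ^ k := by
        rw [Real.volume_Icc, ENNReal.toReal_ofReal (by linarith)]; ring

/-- **Kernel form of `⟨u_k | ϑ(e^τ) 𝔽 u_k⟩`**: `∫_{−Λ}^{Λ} v^k · e^{−τ/2} 𝓕(x^k 1_{[−Λ,Λ]})(e^{−τ}v) dv`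
(`(ϑ(e^τ)η)(v) = e^{−τ/2}η(e^{−τ}v)`; `𝔽 u_k` is represented by the Fourier integral).
[cite: ConnesConsani2021, §4 eq. (40) p. 15; §1 Prop. 1.5 (i) (= arXiv Prop. 8) p. 8] -/
theorem scalingCoeff_monomial_fourier {Λ : ℝ} {k : ℕ} (u : Lp ℂ 2 (volume : Measure ℝ))
    (hu : (u : ℝ → ℂ) =ᵐ[volume] (Icc (-Λ) Λ).indicator fun x : ℝ => (x : ℂ) ^ k) (τ : ℝ) :
    scalingCoeff (u : ℝ → ℂ) (((𝓕 u : Lp ℂ 2 (volume : Measure ℝ))) : ℝ → ℂ) τ =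
      ∫ v in Icc (-Λ) Λ, (v : ℂ) ^ k * ((Real.exp (-τ / 2) : ℂ) *
        𝓕 ((Icc (-Λ) Λ).indicator fun x : ℝ => (x : ℂ) ^ k) (Real.exp (-τ) * v)) := by
  have hu' : u = (memLp_monomial_indicator Λ k).toLp _ := Lp.ext (hu.trans (MemLp.coeFn_toLp _).symm)
  have hF : (((𝓕 u : Lp ℂ 2 (volume : Measure ℝ))) : ℝ → ℂ) =ᵐ[volume]
      𝓕 ((Icc (-Λ) Λ).indicator fun x : ℝ => (x : ℂ) ^ k) := by
    rw [hu']
    exact fourier_toLp_ae_eq_fourierIntegral (integrable_monomial_indicator Λ k) _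
  have hF' := Literature.Analysis.OperatorTheory.ae_eq_comp_smul hF (Real.exp_pos (-τ)).ne'
  rw [scalingCoeff, ← integral_indicator measurableSet_Icc]
  refine integral_congr_ae ?_
  filter_upwards [hu, hF'] with v hv hv'
  simp only [smul_eq_mul] at hv'
  rw [hv, hv']
  by_cases h : v ∈ Icc (-Λ) Λ
  · rw [indicator_of_mem h, indicator_of_mem h, map_pow, Complex.conj_ofReal]
  · simp [indicator_of_notMem h]

/-- Resummation in `x`: `Σ_m ((2πi)^{2m}/(2m)!) v^{2m} 𝓕(x^{2m}1_{[−Λ,Λ]})(y) = ∫_{−Λ}^{Λ} e^{−2πixy} cos(2πxv) dx`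
(cosine series, dominated by `cosh(2π|v|Λ)`). [folklore] -/
private theorem hasSum_fourierIntegral_monomial_even (Λ : ℝ) (v y : ℝ) :
    HasSum (fun m : ℕ => (2 * π * I) ^ (2 * m) / ((2 * m) ! : ℂ) * (v : ℂ) ^ (2 * m) *
        𝓕 ((Icc (-Λ) Λ).indicator fun x : ℝ => (x : ℂ) ^ (2 * m)) y)
      (∫ x in Icc (-Λ) Λ, cexp (-(2 * π * x * y * I)) * Complex.cos (2 * π * x * v)) := by
  have hterm : ∀ m : ℕ, (2 * π * I) ^ (2 * m) / ((2 * m) ! : ℂ) * (v : ℂ) ^ (2 * m) *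
      𝓕 ((Icc (-Λ) Λ).indicator fun x : ℝ => (x : ℂ) ^ (2 * m)) y =
      ∫ x in Icc (-Λ) Λ, (2 * π * I) ^ (2 * m) / ((2 * m) ! : ℂ) * (v : ℂ) ^ (2 * m) *
        (cexp (-(2 * π * x * y * I)) * (x : ℂ) ^ (2 * m)) := by
    intro m; rw [fourierIntegral_indicator_Icc, integral_const_mul]
  simp_rw [hterm]
  haveI : IsFiniteMeasure ((volume : Measure ℝ).restrict (Icc (-Λ) Λ)) := by infer_instance
  have hae : ∀ᵐ x ∂((volume : Measure ℝ).restrict (Icc (-Λ) Λ)), x ∈ Icc (-Λ) Λ :=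
    ae_restrict_mem measurableSet_Icc
  refine hasSum_integral_of_dominated_convergence
    (fun m _ => (2 * π * (|v| * Λ)) ^ (2 * m) / (2 * m) !) (fun m => ?_) (fun m => ?_) ?_ ?_ ?_
  · exact Continuous.aestronglyMeasurable (by fun_prop)
  · filter_upwards [hae] with x hx
    rw [norm_mul, norm_mul, norm_mul, Complex.norm_exp, norm_div, norm_pow, norm_pow,
      Complex.norm_natCast, Complex.norm_real, Real.norm_eq_abs]
    have h0 : ‖2 * (π : ℂ) * I‖ = 2 * π := by
      rw [norm_mul, Complex.norm_I, mul_one, norm_mul, Complex.norm_two, Complex.norm_real,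
        Real.norm_eq_abs, abs_of_pos Real.pi_pos]
    have hre : (-(2 * π * (x : ℂ) * y * I)).re = 0 := by
      simp [Complex.mul_re, Complex.mul_im, Complex.I_re, Complex.I_im]
    rw [h0, hre, Real.exp_zero, one_mul]
    have h1 := norm_ofReal_pow_le hx (2 * m)
    have h2 : (0 : ℝ) ≤ (2 * π) ^ (2 * m) / (2 * m) ! := by positivity
    calc (2 * π) ^ (2 * m) / ↑(2 * m) ! * |v| ^ (2 * m) * ‖(x : ℂ) ^ (2 * m)‖
        ≤ (2 * π) ^ (2 * m) / ↑(2 * m) ! * |v| ^ (2 * m) * Λ ^ (2 * m) := by gcongr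
      _ = (2 * π * (|v| * Λ)) ^ (2 * m) / ↑(2 * m) ! := by ring
  · refine Eventually.of_forall fun x => ?_
    exact (Real.summable_pow_div_factorial (2 * π * (|v| * Λ))).comp_injective
      (fun a b h => by simpa using h : Function.Injective fun m : ℕ => 2 * m)
  · exact integrable_const _
  · refine Eventually.of_forall fun x => ?_
    have h := (Complex.hasSum_cos' (2 * π * x * v)).mul_left (cexp (-(2 * π * x * y * I)))
    refine h.congr_fun fun m => ?_
    rw [mul_pow, mul_pow, mul_pow, mul_pow, mul_pow]
    ring

/-- Resummation in `v`: for `E ∈ ℂ`, `a ∈ ℝ`,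
`Σ_m ((2πi)^{2m}/(2m)!) ∫_{−Λ}^{Λ} v^{2m} E 𝓕(x^{2m}1)(a v) dv = ∫_{−Λ}^{Λ} E ∫_{−Λ}^{Λ} e^{−2πixav} cos(2πxv) dx dv`.
[folklore] -/
private theorem hasSum_integral_monomial_even {Λ : ℝ} (hΛ : 0 < Λ) (E : ℂ) (a : ℝ) :
    HasSum (fun m : ℕ => (2 * π * I) ^ (2 * m) / ((2 * m) ! : ℂ) *
        ∫ v in Icc (-Λ) Λ, (v : ℂ) ^ (2 * m) *
          (E * 𝓕 ((Icc (-Λ) Λ).indicator fun x : ℝ => (x : ℂ) ^ (2 * m)) (a * v)))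
      (∫ v in Icc (-Λ) Λ, E * ∫ x in Icc (-Λ) Λ,
        cexp (-(2 * π * x * (a * v) * I)) * Complex.cos (2 * π * x * v)) := by
  have hterm : ∀ m : ℕ, (2 * π * I) ^ (2 * m) / ((2 * m) ! : ℂ) *
      ∫ v in Icc (-Λ) Λ, (v : ℂ) ^ (2 * m) *
        (E * 𝓕 ((Icc (-Λ) Λ).indicator fun x : ℝ => (x : ℂ) ^ (2 * m)) (a * v)) =
      ∫ v in Icc (-Λ) Λ, E * ((2 * π * I) ^ (2 * m) / ((2 * m) ! : ℂ) * (v : ℂ) ^ (2 * m) *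
        𝓕 ((Icc (-Λ) Λ).indicator fun x : ℝ => (x : ℂ) ^ (2 * m)) (a * v)) := by
    intro m
    rw [← integral_const_mul]
    refine setIntegral_congr_fun measurableSet_Icc fun v _ => ?_
    ring
  simp_rw [hterm]
  haveI : IsFiniteMeasure ((volume : Measure ℝ).restrict (Icc (-Λ) Λ)) := by infer_instance
  have hae : ∀ᵐ x ∂((volume : Measure ℝ).restrict (Icc (-Λ) Λ)), x ∈ Icc (-Λ) Λ :=
    ae_restrict_mem measurableSet_Icc
  have hcont : ∀ m : ℕ, Continuous (𝓕 ((Icc (-Λ) Λ).indicator fun x : ℝ => (x : ℂ) ^ (2 * m))) :=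
    fun m => continuous_fourierIntegral (integrable_monomial_indicator Λ (2 * m))
  refine hasSum_integral_of_dominated_convergence
    (fun m _ => ‖E‖ * ((2 * π * Λ ^ 2) ^ (2 * m) / (2 * m) ! * (2 * Λ))) (fun m => ?_) (fun m => ?_)
    ?_ ?_ ?_
  · exact Continuous.aestronglyMeasurable
      (continuous_const.mul ((Continuous.mul (by fun_prop) ((hcont m).comp (by fun_prop)))))
  · filter_upwards [hae] with v hv
    rw [norm_mul, norm_mul, norm_mul, norm_twoPiI_pow_div_factorial]
    have h1 := norm_ofReal_pow_le hv (2 * m)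
    have h2 := norm_fourierIntegral_monomial_le hΛ (2 * m) (a * v)
    have h3 : (0 : ℝ) ≤ (2 * π) ^ (2 * m) / (2 * m) ! := by positivity
    calc ‖E‖ * ((2 * π) ^ (2 * m) / ↑(2 * m)! * ‖(v : ℂ) ^ (2 * m)‖ *
          ‖𝓕 ((Icc (-Λ) Λ).indicator fun x : ℝ => (x : ℂ) ^ (2 * m)) (a * v)‖)
        ≤ ‖E‖ * ((2 * π) ^ (2 * m) / ↑(2 * m)! * Λ ^ (2 * m) * (2 * Λ * Λ ^ (2 * m))) := by gcongr
      _ = ‖E‖ * ((2 * π * Λ ^ 2) ^ (2 * m) / ↑(2 * m)! * (2 * Λ)) := by ring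
  · refine Eventually.of_forall fun v => ?_
    have h1 : Summable fun m : ℕ => (2 * π * Λ ^ 2) ^ (2 * m) / (2 * m) ! :=
      (Real.summable_pow_div_factorial (2 * π * Λ ^ 2)).comp_injective
        (fun a b h => by simpa using h : Function.Injective fun m : ℕ => 2 * m)
    exact (h1.mul_right (2 * Λ)).mul_left ‖E‖
  · exact integrable_const _
  · refine Eventually.of_forall fun v => ?_
    have h := (hasSum_fourierIntegral_monomial_even Λ v (a * v)).mul_left E
    simpa only [Complex.ofReal_mul] using h

/-- A Weil test function times `e^{−τ/2}` is integrable (compact support). [folklore] -/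
private theorem integrable_norm_mul_exp_of_isWeilTest {g : ℝ → ℂ} (hg : IsWeilTest g) (C : ℝ) :
    Integrable fun τ : ℝ => ‖g τ‖ * Real.exp (-τ / 2) * C := by
  have h1 : Continuous fun τ : ℝ => ‖g τ‖ * Real.exp (-τ / 2) * C :=
    ((hg.1.continuous.norm).mul (by fun_prop)).mul continuous_const
  refine h1.integrable_of_hasCompactSupport ?_
  exact (hg.2.norm.mul_right).mul_right

/-- Resummation in `τ`: **`Σ_m ((2πi)^{2m}/(2m)!) ⟪u_{2m}, ϑ(f) 𝔽 u_{2m}⟫ =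
∫ g(τ) ∫_{−Λ}^{Λ} e^{−τ/2} ∫_{−Λ}^{Λ} e^{−2πix e^{−τ}v} cos(2πxv) dx dv dτ`** (dominated by
`|g(τ)| e^{−τ/2} 4Λ² cosh(2πΛ²)`). [cite: ConnesConsani2021, §1 Prop. 1.5 (i)–(ii) (= arXiv Prop. 8) p. 8] -/
theorem hasSum_even_monomial_inner_scalingOp {g : ℝ → ℂ} (hg : IsWeilTest g) {Λ : ℝ} (hΛ : 0 < Λ)
    (u : ℕ → Lp ℂ 2 (volume : Measure ℝ))
    (hu : ∀ k, (u k : ℝ → ℂ) =ᵐ[volume] (Icc (-Λ) Λ).indicator fun x : ℝ => (x : ℂ) ^ k) :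
    HasSum (fun m : ℕ => (2 * π * I) ^ (2 * m) / ((2 * m) ! : ℂ) *
        ⟪u (2 * m), scalingOp g ((𝓕 (u (2 * m)) : Lp ℂ 2 (volume : Measure ℝ)))⟫_ℂ)
      (∫ τ, g τ * ∫ v in Icc (-Λ) Λ, (Real.exp (-τ / 2) : ℂ) * ∫ x in Icc (-Λ) Λ,
        cexp (-(2 * π * x * (Real.exp (-τ) * v) * I)) * Complex.cos (2 * π * x * v)) := by
  have hgi : Integrable g := hg.1.continuous.integrable_of_hasCompactSupport hg.2
  have hterm : ∀ m : ℕ, (2 * π * I) ^ (2 * m) / ((2 * m) ! : ℂ) *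
      ⟪u (2 * m), scalingOp g ((𝓕 (u (2 * m)) : Lp ℂ 2 (volume : Measure ℝ)))⟫_ℂ =
      ∫ τ, g τ * ((2 * π * I) ^ (2 * m) / ((2 * m) ! : ℂ) *
        scalingCoeff (u (2 * m) : ℝ → ℂ) (((𝓕 (u (2 * m)) : Lp ℂ 2 (volume : Measure ℝ))) : ℝ → ℂ) τ) := by
    intro m
    rw [inner_scalingOp hgi, ← integral_const_mul]
    refine integral_congr_ae (Eventually.of_forall fun τ => ?_)
    ring
  simp_rw [hterm]
  refine hasSum_integral_of_dominated_convergence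
    (fun m τ => ‖g τ‖ * Real.exp (-τ / 2) * (4 * Λ ^ 2) * ((2 * π * Λ ^ 2) ^ (2 * m) / (2 * m) !))
    (fun m => ?_) (fun m => ?_) ?_ ?_ ?_
  · refine hg.1.continuous.aestronglyMeasurable.mul (Continuous.aestronglyMeasurable ?_)
    refine continuous_const.mul ?_
    have : scalingCoeff (u (2 * m) : ℝ → ℂ)
        (((𝓕 (u (2 * m)) : Lp ℂ 2 (volume : Measure ℝ))) : ℝ → ℂ) =
        fun τ => ⟪u (2 * m), scalingUnitary τ ((𝓕 (u (2 * m)) : Lp ℂ 2 (volume : Measure ℝ)))⟫_ℂ :=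
      funext fun τ => scalingCoeff_eq_inner_scalingUnitary _ _ τ
    rw [this]
    exact continuous_const.inner (continuous_scalingUnitary_apply _)
  · refine Eventually.of_forall fun τ => ?_
    rw [norm_mul, norm_mul, norm_twoPiI_pow_div_factorial, scalingCoeff_monomial_fourier _ (hu _)]
    have hb : ∀ v ∈ Icc (-Λ) Λ, ‖(v : ℂ) ^ (2 * m) * ((Real.exp (-τ / 2) : ℂ) *
        𝓕 ((Icc (-Λ) Λ).indicator fun x : ℝ => (x : ℂ) ^ (2 * m)) (Real.exp (-τ) * v))‖ ≤
        Λ ^ (2 * m) * (Real.exp (-τ / 2) * (2 * Λ * Λ ^ (2 * m))) := by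
      intro v hv
      rw [norm_mul, norm_mul, Complex.norm_real, Real.norm_eq_abs, abs_of_pos (Real.exp_pos _)]
      have h1 := norm_ofReal_pow_le hv (2 * m)
      have h2 := norm_fourierIntegral_monomial_le hΛ (2 * m) (Real.exp (-τ) * v)
      have h3 := (Real.exp_pos (-τ / 2)).le
      gcongr
    have hI := norm_setIntegral_le_of_norm_le_const (by simp [Real.volume_Icc]) hb
      (μ := (volume : Measure ℝ))
    rw [Measure.real, Real.volume_Icc, ENNReal.toReal_ofReal (by linarith)] at hI
    have h4 : (0 : ℝ) ≤ (2 * π) ^ (2 * m) / (2 * m) ! := by positivity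
    calc ‖g τ‖ * ((2 * π) ^ (2 * m) / ↑(2 * m)! *
          ‖∫ v in Icc (-Λ) Λ, (v : ℂ) ^ (2 * m) * ((Real.exp (-τ / 2) : ℂ) *
            𝓕 ((Icc (-Λ) Λ).indicator fun x : ℝ => (x : ℂ) ^ (2 * m)) (Real.exp (-τ) * v))‖)
        ≤ ‖g τ‖ * ((2 * π) ^ (2 * m) / ↑(2 * m)! *
          (Λ ^ (2 * m) * (Real.exp (-τ / 2) * (2 * Λ * Λ ^ (2 * m))) * (Λ - -Λ))) := by gcongr
      _ = ‖g τ‖ * Real.exp (-τ / 2) * (4 * Λ ^ 2) * ((2 * π * Λ ^ 2) ^ (2 * m) / ↑(2 * m)!) := by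
          ring
  · refine Eventually.of_forall fun τ => ?_
    have h1 : Summable fun m : ℕ => (2 * π * Λ ^ 2) ^ (2 * m) / (2 * m) ! :=
      (Real.summable_pow_div_factorial (2 * π * Λ ^ 2)).comp_injective
        (fun a b h => by simpa using h : Function.Injective fun m : ℕ => 2 * m)
    exact h1.mul_left _
  · have : (fun τ => ∑' m : ℕ, ‖g τ‖ * Real.exp (-τ / 2) * (4 * Λ ^ 2) *
        ((2 * π * Λ ^ 2) ^ (2 * m) / (2 * m) !)) = fun τ => ‖g τ‖ * Real.exp (-τ / 2) *
          ((4 * Λ ^ 2) * ∑' m : ℕ, (2 * π * Λ ^ 2) ^ (2 * m) / (2 * m) !) := by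
      funext τ; rw [tsum_mul_left]; ring_nf
    rw [this]
    exact integrable_norm_mul_exp_of_isWeilTest hg _
  · refine Eventually.of_forall fun τ => ?_
    have h := (hasSum_integral_monomial_even hΛ (Real.exp (-τ / 2) : ℂ) (Real.exp (-τ))).mul_left (g τ)
    refine h.congr_fun fun m => ?_
    rw [scalingCoeff_monomial_fourier _ (hu _)]

/-! ## §7. Main theorems (hypothesis-free; `u_k` instantiated) -/

/-- **Summability** — the first conjunct of `Connes1999_thm_VII_4_rat` at `P = ∅`, PROVED: for every test
function `g`, `Λ > 0` and every Hilbert basis `b` of `L²(ℝ)_ev`, the diagonal series of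
`ϑ(f) 𝔽 P_Λ 𝔽⁻¹ P_Λ` along `b` is summable.  RH-FREE.
[cite: Connes1999, §V Thm 3 (K = ℝ) and §VII Thm 4; Connes2026Letter, §7.1 (arXiv p0024:L24)] -/
theorem summable_diagCoeff_cutoff {g : ℝ → ℂ} (hg : IsWeilTest g) {Λ : ℝ} (hΛ : 0 < Λ)
    {ι : Type*} (b : HilbertBasis ι ℂ evenPart) :
    Summable fun i => diagCoeff g (fourierL2 * cutoffProj Λ * fourierL2Inv * cutoffProj Λ)
      ((b i : evenPart) : Lp ℂ 2 (volume : Measure ℝ)) := by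
  have hgi : Integrable g := hg.1.continuous.integrable_of_hasCompactSupport hg.2
  exact (hasSum_even_monomial_diagCoeff_cutoff hgi hΛ b
    (fun k => (memLp_monomial_indicator Λ k).toLp _) (fun k => MemLp.coeFn_toLp _)).1

/-- **The diagonal series is the `Δ`-integral at scale `Λ`**:
`Σ_i ⟪b_i, ϑ(f) 𝔽 P_Λ 𝔽⁻¹ P_Λ b_i⟫ = ∫ g(τ) ∫_{−Λ}^{Λ} e^{−τ/2} ∫_{−Λ}^{Λ} e^{−2πixe^{−τ}v} cos(2πxv) dx dv dτ`
for every Hilbert basis `b` of `L²(ℝ)_ev` — the archimedean instance (`S = {∞}`, even = `K_S`-invariant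
part) of the left-hand side of Connes' trace formula, evaluated as in CC2021 §1 (kernel on the diagonal).
RH-FREE. [cite: Connes1999, §V Thm 3 (K = ℝ); ConnesConsani2021, §1 Prop. 1.5 (ii) (= arXiv Prop. 8) p. 8; Connes2026Letter, §7.1 (arXiv p0024:L24)] -/
theorem tsum_diagCoeff_cutoff_eq_integral {g : ℝ → ℂ} (hg : IsWeilTest g) {Λ : ℝ} (hΛ : 0 < Λ)
    {ι : Type*} (b : HilbertBasis ι ℂ evenPart) :
    ∑' i, diagCoeff g (fourierL2 * cutoffProj Λ * fourierL2Inv * cutoffProj Λ)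
        ((b i : evenPart) : Lp ℂ 2 (volume : Measure ℝ)) =
      ∫ τ, g τ * ∫ v in Icc (-Λ) Λ, (Real.exp (-τ / 2) : ℂ) * ∫ x in Icc (-Λ) Λ,
        cexp (-(2 * π * x * (Real.exp (-τ) * v) * I)) * Complex.cos (2 * π * x * v) := by
  have hgi : Integrable g := hg.1.continuous.integrable_of_hasCompactSupport hg.2
  have h1 := (hasSum_even_monomial_diagCoeff_cutoff hgi hΛ b
    (fun k => (memLp_monomial_indicator Λ k).toLp _) (fun k => MemLp.coeFn_toLp _)).2
  have h2 := hasSum_even_monomial_inner_scalingOp hg hΛ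
    (fun k => (memLp_monomial_indicator Λ k).toLp _) (fun k => MemLp.coeFn_toLp _)
  exact h1.unique h2

end Literature.NumberTheory.Connes2026
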